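import Summits.QuantumAdvantage.AdviceFreeQNC0.TensorBlocks
import HarnessLib

/-!
# Cell qa-qnc0 (rung F-Q1, route RingFrame, crux α `RingToElim` / density target T10): BLOCK SPLITTING
# at block degree `t` — `blockSplit : ∀ t, BlockSplit t` (planner qa-qnc0-p1 ROUND-12 §2.1, Sketch13)

**Theorem** (`blockSplit`, the Sketch13 statement `BlockSplit t` VERBATIM, all `t`).  Cut `[n]` into
`k ≤ n` consecutive blocks (`blockIdx n k i = ⌊ik/n⌋`).  Every walk strategy `y` (any charge `c`) whose
selectors have `𝔽₂`-degree `≤ D < (t+1)(k−1)` has its WIN pattern `ringWinU c y` in the `k`-block SUM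
CODE at block degree `t` (`SumCodeWin n k t`): `WIN = ⊕_{j<k} X_j`, each `X_j(u) = T^j_{|u_j| mod 3}(u)`
for an EVEN triple `T^j_0 ⊕ T^j_1 ⊕ T^j_2 ≡ 0` of block-`j` degree `≤ t`.

Proof (ROUND-12 §2.1 / TARGET §16.1).  In `𝔽₂`, `WIN(u) = Σ_g y_g(u)·[c + g + W(u) + W_{<g}(u) ≢ 0]`;
expand `y_g = Σ_S a_{g,S} u^S` (`|S| ≤ D`); ASSIGN a term `(g, S)` to a block `j` not straddling the
cut `g` with `|S ∩ B_j| ≤ t` (at most one block straddles `g` since `blockIdx` is monotone; pigeonhole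
`exists_block`).  Then `W + W_{<g} = e·|u_j| + off_{j,g}` with `e ∈ {1,2}`, `off` blind to block `j`
(`walkExp_split`), so `X_j := Σ_{(g,S) ↦ j} a_{g,S} u^S [c + g + e|u_j| + off ≢ 0] = T^j_{|u_j| mod 3}`,
`T^j_r := Σ a_{g,S} u^S [c + g + er + off ≢ 0]`: block degree `≤ t`, even (`{er + A}_{r<3} = ℤ/3`).
Corollaries: `t10W_of_tensorMult`, `t10W_of_tensorMultOne` (T10W ⟸ MULT₁ alone).  The cell's theorem
(qa-qnc0-p1 gen 13 / qa-qnc0-prover gen 7; not in print).  WHAT THIS IS NOT: nothing on `TensorMult`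
(MULT₁ open); no bound on any win count; α untouched.
-/

noncomputable section

open scoped Classical

namespace Summit.QuantumAdvantage.AdviceFreeQNC0

open Finset
open Literature.Computability.MetaComplexity Literature.Computability.MetaComplexity.Smolensky

namespace BlockSplitting

variable {n : ℕ}

/-! ### Indicators in `𝔽₂` -/

/-- The `𝔽₂`-valued indicator of a Boolean function (the function whose membership in `lowDeg`
is `HasDeg`). -/
def indF2 (f : (Fin n → Bool) → Bool) : CubeFn (ZMod 2) n := fun x => if f x = true then 1 else 0

/-- `HasDeg f d ↔ indF2 f ∈ lowDeg d` (definitional). -/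
theorem hasDeg_iff_indF2 (f : (Fin n → Bool) → Bool) (d : ℕ) :
    HasDeg f d ↔ indF2 f ∈ lowDeg (ZMod 2) n d := Iff.rfl

/-- `indF2 (u ↦ [τ u = 1]) = τ`. -/
theorem indF2_decide (τ : (Fin n → Bool) → ZMod 2) : indF2 (fun u => decide (τ u = 1)) = τ := by
  funext u
  show (if decide (τ u = 1) = true then (1 : ZMod 2) else 0) = τ u
  generalize τ u = x
  fin_cases x <;> decide

/-- `[x ≢ 0 (mod 3)]` as an element of `𝔽₂`. -/
def nz3 (x : ℕ) : ZMod 2 := if x % 3 = 0 then 0 else 1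

/-- `nz3` only depends on the residue mod `3`. -/
theorem nz3_congr {x y : ℕ} (h : x % 3 = y % 3) : nz3 x = nz3 y := by
  unfold nz3; rw [h]

/-- EVENNESS: for `e ∈ {1,2}` the three residues `A + e·r`, `r < 3`, cover `ℤ/3`, so exactly two of
them are non-zero: `Σ_{r<3} [A + e·r ≢ 0] = 0` in `𝔽₂`. -/
theorem nz3_triple (A e : ℕ) (he : e = 1 ∨ e = 2) :
    nz3 (A + e * 0) + nz3 (A + e * 1) + nz3 (A + e * 2) = 0 := by
  have key : ∀ a < 3, (nz3 (a + 1 * 0) + nz3 (a + 1 * 1) + nz3 (a + 1 * 2) = 0) ∧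
      (nz3 (a + 2 * 0) + nz3 (a + 2 * 1) + nz3 (a + 2 * 2) = 0) := by decide
  have ha : A % 3 < 3 := Nat.mod_lt _ (by norm_num)
  have e3 : ∀ r, nz3 (A + e * r) = nz3 (A % 3 + e * r) := fun r => nz3_congr (by omega)
  rw [e3, e3, e3]
  rcases he with rfl | rfl
  · exact (key _ ha).1
  · exact (key _ ha).2

/-- `xor` of three Booleans vanishes when their `𝔽₂`-indicators sum to `0`. -/
theorem xor3_eq_false_of_sum {a b c : ZMod 2} (h : a + b + c = 0) :
    xor (decide (a = 1)) (xor (decide (b = 1)) (decide (c = 1))) = false := by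
  revert a b c; decide

/-- Parity of a filtered cardinality as a sum of `𝔽₂`-indicators. -/
theorem card_filter_mod_two {ι : Type*} (s : Finset ι) (p : ι → Prop) [DecidablePred p] :
    (((s.filter p).card : ℕ) : ZMod 2) = ∑ i ∈ s, (if p i then (1 : ZMod 2) else 0) := by
  rw [Finset.natCast_card_filter]

/-- `m % 2 = 1 ↔ (m : 𝔽₂) = 1`. -/
theorem mod_two_eq_one_iff (m : ℕ) : m % 2 = 1 ↔ ((m : ℕ) : ZMod 2) = 1 := by
  rw [ZMod.natCast_eq_one_iff_odd, Nat.odd_iff]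

/-! ### Blocks -/

variable {k : ℕ}

/-- Block indices are `< k`. -/
theorem blockIdx_lt (hk : 0 < k) (i : Fin n) : blockIdx n k i < k := by
  unfold blockIdx
  have hn : 0 < n := lt_of_le_of_lt (Nat.zero_le _) i.isLt
  rw [Nat.div_lt_iff_lt_mul hn, Nat.mul_comm k n]
  exact Nat.mul_lt_mul_of_pos_right i.isLt hk

/-- `blockIdx` is monotone in the position (blocks are consecutive intervals). -/
theorem blockIdx_mono {i i' : Fin n} (h : i.val ≤ i'.val) : blockIdx n k i ≤ blockIdx n k i' := by
  unfold blockIdx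
  exact Nat.div_le_div_right (Nat.mul_le_mul_right k h)

/-- Block `j` STRADDLES the cut `g`: it has a position before the cut and one at or after it. -/
def Straddle (n k j g : ℕ) : Prop :=
  ∃ i i' : Fin n, blockIdx n k i = j ∧ blockIdx n k i' = j ∧ i.val < g ∧ g ≤ i'.val

/-- At most one block straddles a given cut. -/
theorem straddle_unique {j j' g : ℕ} (h : Straddle n k j g) (h' : Straddle n k j' g) : j = j' := by
  obtain ⟨i, i', hi, hi', hig, hgi'⟩ := h
  obtain ⟨l, l', hl, hl', hlg, hgl'⟩ := h'
  have h1 : blockIdx n k l ≤ blockIdx n k i' := blockIdx_mono (by omega)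
  have h2 : blockIdx n k i ≤ blockIdx n k l' := blockIdx_mono (by omega)
  rw [hl, hi'] at h1
  rw [hi, hl'] at h2
  omega

/-- **Pigeonhole**: for `D < (t+1)(k−1)` and `|S| ≤ D`, some block `j < k` does not straddle the cut
`g` and meets `S` in at most `t` positions. -/
theorem exists_block {t D : ℕ} (hk : 0 < k) (hD : D < (t + 1) * (k - 1)) (g : ℕ)
    (S : Finset (Fin n)) (hS : S.card ≤ D) :
    ∃ j, j < k ∧ ¬ Straddle n k j g ∧ (S.filter fun i => blockIdx n k i = j).card ≤ t := by
  by_contra hcon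
  have hcon' : ∀ j, j < k → ¬ Straddle n k j g →
      t + 1 ≤ (S.filter fun i => blockIdx n k i = j).card := by
    intro j hj hns
    by_contra hle
    exact hcon ⟨j, hj, hns, by omega⟩
  -- the blocks that do not straddle `g`
  set J : Finset ℕ := (range k).filter fun j => ¬ Straddle n k j g with hJ
  have hJcard : k - 1 ≤ J.card := by
    have hsum := Finset.card_filter_add_card_filter_not (s := range k) (fun j => Straddle n k j g)
    have hle1 : ((range k).filter fun j => Straddle n k j g).card ≤ 1 := by
      rw [Finset.card_le_one]
      intro a ha b hb
      exact straddle_unique (mem_filter.1 ha).2 (mem_filter.1 hb).2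
    rw [card_range] at hsum
    have : J.card = ((range k).filter fun j => ¬ Straddle n k j g).card := by rw [hJ]
    omega
  -- `|S| = Σ_{j<k} |S ∩ B_j| ≥ Σ_{j ∈ J} |S ∩ B_j| ≥ (t+1)·|J|`
  have hfib : S.card = ∑ j ∈ range k, (S.filter fun i => blockIdx n k i = j).card :=
    card_eq_sum_card_fiberwise fun i _ => mem_range.2 (blockIdx_lt hk i)
  have hJsum : ∑ j ∈ J, (S.filter fun i => blockIdx n k i = j).card ≤ S.card := by
    rw [hfib]
    exact sum_le_sum_of_subset_of_nonneg (filter_subset _ _) fun _ _ _ => Nat.zero_le _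
  have hbig : (t + 1) * J.card ≤ ∑ j ∈ J, (S.filter fun i => blockIdx n k i = j).card := by
    rw [mul_comm, card_eq_sum_ones, sum_mul, one_mul]
    refine sum_le_sum fun j hj => ?_
    have hj' := mem_filter.1 hj
    exact hcon' j (mem_range.1 hj'.1) hj'.2
  have h1 : (t + 1) * (k - 1) ≤ (t + 1) * J.card := Nat.mul_le_mul_left _ hJcard
  omega

/-! ### The exponent off the block -/

/-- Weight outside block `j`. -/
def wtOff (n k j : ℕ) (u : Fin n → Bool) : ℕ :=
  (univ.filter fun i : Fin n => ¬ blockIdx n k i = j ∧ u i = true).card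

/-- Prefix weight (positions `< g`) outside block `j`. -/
def prefOff (n k j g : ℕ) (u : Fin n → Bool) : ℕ :=
  (univ.filter fun i : Fin n => i.val < g ∧ ¬ blockIdx n k i = j ∧ u i = true).card

/-- The part of the walk exponent `W(u) + W_{<g}(u)` that does not read block `j`. -/
def offExp (n k j g : ℕ) (u : Fin n → Bool) : ℕ := wtOff n k j u + prefOff n k j g u

/-- The multiplier of `|u_j|` in the walk exponent: `2` if block `j` lies left of the cut `g`
(all its positions `< g`), else `1`. -/
def eCoef (n k j g : ℕ) : ℕ := if ∀ i : Fin n, blockIdx n k i = j → i.val < g then 2 else 1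

/-- `eCoef ∈ {1, 2}`. -/
theorem eCoef_cases (j g : ℕ) : eCoef n k j g = 1 ∨ eCoef n k j g = 2 := by
  unfold eCoef; split_ifs
  · exact Or.inr rfl
  · exact Or.inl rfl

/-- `W(u) = |u_j| + wtOff_j(u)`. -/
theorem wt_split (j : ℕ) (u : Fin n → Bool) : wt u = blockWt n k j u + wtOff n k j u := by
  unfold wt blockWt wtOff
  rw [← Finset.card_filter_add_card_filter_not (s := univ.filter fun i : Fin n => u i = true)
    (fun i => blockIdx n k i = j), filter_filter, filter_filter]
  congr 1
  · exact congrArg _ (filter_congr fun i _ => by tauto)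
  · exact congrArg _ (filter_congr fun i _ => by tauto)

/-- `W_{<g}(u) = [block j left of g]·|u_j| + prefOff_{j,g}(u)` when block `j` does not straddle `g`. -/
theorem wtPrefix_split {j g : ℕ} (hns : ¬ Straddle n k j g) (u : Fin n → Bool) :
    wtPrefix u g = (eCoef n k j g - 1) * blockWt n k j u + prefOff n k j g u := by
  unfold wtPrefix prefOff
  rw [← Finset.card_filter_add_card_filter_not
    (s := univ.filter fun i : Fin n => i.val < g ∧ u i = true)
    (fun i => blockIdx n k i = j), filter_filter, filter_filter]
  have e2 : (univ.filter fun i : Fin n => (i.val < g ∧ u i = true) ∧ ¬ blockIdx n k i = j) =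
      univ.filter fun i : Fin n => i.val < g ∧ ¬ blockIdx n k i = j ∧ u i = true :=
    filter_congr fun i _ => by tauto
  rw [e2]
  congr 1
  unfold eCoef
  split_ifs with hleft
  · -- every position of block `j` is `< g`
    rw [show 2 - 1 = 1 from rfl, one_mul]
    unfold blockWt
    exact congrArg _ (filter_congr fun i _ =>
      ⟨fun h => ⟨h.2, h.1.2⟩, fun h => ⟨⟨hleft i h.1, h.2⟩, h.1⟩⟩)
  · -- some position of block `j` is `≥ g`, hence (no straddle) all are
    rw [show 1 - 1 = 0 from rfl, zero_mul]
    simp only [not_forall, not_lt] at hleft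
    obtain ⟨i', hi', hgi'⟩ := hleft
    rw [Finset.card_eq_zero, Finset.filter_eq_empty_iff]
    intro i _ h
    exact hns ⟨i, i', h.2, hi', h.1.1, hgi'⟩

/-- **The walk exponent splits off block `j`** (no straddle):
`W(u) + W_{<g}(u) = e·|u_j| + offExp_{j,g}(u)`, `e = eCoef ∈ {1,2}`. -/
theorem walkExp_split {j g : ℕ} (hns : ¬ Straddle n k j g) (u : Fin n → Bool) :
    walkExp u g = eCoef n k j g * blockWt n k j u + offExp n k j g u := by
  unfold walkExp offExp
  rw [wt_split (k := k) j u, wtPrefix_split hns u]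
  rcases eCoef_cases (n := n) (k := k) j g with h | h <;> rw [h] <;> omega

/-- `offExp` does not read block `j`. -/
theorem offExp_merge (j g : ℕ) (v w : Fin n → Bool) :
    offExp n k j g (mergeBlock n k j v w) = offExp n k j g v := by
  unfold offExp wtOff prefOff mergeBlock
  congr 1
  · exact congrArg _ (filter_congr fun i _ => by
      constructor
      · rintro ⟨h1, h2⟩; rw [if_neg h1] at h2; exact ⟨h1, h2⟩
      · rintro ⟨h1, h2⟩; rw [if_neg h1]; exact ⟨h1, h2⟩)
  · exact congrArg _ (filter_congr fun i _ => by
      constructor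
      · rintro ⟨h0, h1, h2⟩; rw [if_neg h1] at h2; exact ⟨h0, h1, h2⟩
      · rintro ⟨h0, h1, h2⟩; rw [if_neg h1]; exact ⟨h0, h1, h2⟩)

/-- A monomial inside block `j` reads only the block-`j` bits of a merge. -/
theorem mono_merge_in (j : ℕ) (S : Finset (Fin n)) (v w : Fin n → Bool) :
    mono (ZMod 2) (S.filter fun i => blockIdx n k i = j) (mergeBlock n k j v w) =
      mono (ZMod 2) (S.filter fun i => blockIdx n k i = j) w := by
  unfold mono
  refine prod_congr rfl fun i hi => ?_
  have : mergeBlock n k j v w i = w i := by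
    unfold mergeBlock; rw [if_pos (mem_filter.1 hi).2]
  rw [this]

/-- A monomial outside block `j` does not read the block-`j` bits of a merge. -/
theorem mono_merge_out (j : ℕ) (S : Finset (Fin n)) (v w : Fin n → Bool) :
    mono (ZMod 2) (S.filter fun i => ¬ blockIdx n k i = j) (mergeBlock n k j v w) =
      mono (ZMod 2) (S.filter fun i => ¬ blockIdx n k i = j) v := by
  unfold mono
  refine prod_congr rfl fun i hi => ?_
  have : mergeBlock n k j v w i = v i := by
    unfold mergeBlock; rw [if_neg (mem_filter.1 hi).2]
  rw [this]

/-- `u^S = u^{S ∩ B_j} · u^{S ∖ B_j}`. -/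
theorem mono_split (j : ℕ) (S : Finset (Fin n)) :
    mono (ZMod 2) S = mono (ZMod 2) (S.filter fun i => blockIdx n k i = j) *
      mono (ZMod 2) (S.filter fun i => ¬ blockIdx n k i = j) := by
  rw [mono_mul, filter_union_filter_not_eq]

end BlockSplitting

open BlockSplitting

/-! ### The theorem -/

/-- **BLOCK SPLITTING — PROVED** (all block degrees `t`): the Sketch13 statement `BlockSplit t`,
verbatim.  The cell's theorem (planner qa-qnc0-p1 ROUND-12 §2.1, ask P18). -/
theorem blockSplit (t : ℕ) : BlockSplit t := by
  classical
  intro n k D c y hk hkn hD hdeg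
  /- Step A: monomial expansion of the selectors, `indF2 (y g) = Σ_S a g S • u^S` -/
  have hexp : ∀ g : Fin (n + 1), ∃ a : {S : Finset (Fin n) // S.card ≤ D} →₀ ZMod 2,
      (a.sum fun S r => r • mono (ZMod 2) S.1) = indF2 (y g) := fun g =>
    Finsupp.mem_span_range_iff_exists_finsupp.1 ((hasDeg_iff_indF2 _ _).1 (hdeg g))
  choose a ha using hexp
  have hyu : ∀ g u, indF2 (y g) u = ∑ S ∈ (a g).support, a g S * mono (ZMod 2) S.1 u := by
    intro g u
    rw [← ha g, Finsupp.sum, Finset.sum_apply]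
    exact sum_congr rfl fun S _ => by simp [Pi.smul_apply, smul_eq_mul]
  /- Step D: the block assigned to a term `(g, S)` -/
  have hassign : ∀ σ : (Σ g : Fin (n + 1), {S : Finset (Fin n) // S.card ≤ D}),
      ∃ j, j < k ∧ ¬ Straddle n k j σ.1.val ∧
        (σ.2.1.filter fun i => blockIdx n k i = j).card ≤ t :=
    fun σ => exists_block hk hD σ.1.val σ.2.1 σ.2.2
  choose blk hblk_lt hblk_ns hblk_card using hassign
  /- the terms, their coefficients and the block triples -/
  set Tm : Finset (Σ g : Fin (n + 1), {S : Finset (Fin n) // S.card ≤ D}) :=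
    univ.sigma fun g => (a g).support with hTm
  set τ : ℕ → ℕ → (Fin n → Bool) → ZMod 2 := fun j r u =>
    ∑ σ ∈ Tm.filter (fun σ => blk σ = j),
      a σ.1 σ.2 * mono (ZMod 2) σ.2.1 u *
        nz3 (c + σ.1.val + eCoef n k j σ.1.val * r + offExp n k j σ.1.val u) with hτ
  set T : ℕ → ℕ → (Fin n → Bool) → Bool := fun j r u => decide (τ j r u = 1) with hT
  refine ⟨fun j u => T j (blockWt n k j u % 3) u, fun j _ => ⟨T j, ?_, ?_, fun u => rfl⟩, ?_⟩
  /- Step G: block degree `≤ t` -/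
  · intro r v
    rw [hasDeg_iff_indF2]
    have hfun : indF2 (fun w => T j r (mergeBlock n k j v w)) =
        ∑ σ ∈ Tm.filter (fun σ => blk σ = j),
          (a σ.1 σ.2 * mono (ZMod 2) (σ.2.1.filter fun i => ¬ blockIdx n k i = j) v *
            nz3 (c + σ.1.val + eCoef n k j σ.1.val * r + offExp n k j σ.1.val v)) •
          mono (ZMod 2) (σ.2.1.filter fun i => blockIdx n k i = j) := by
      have e1 : indF2 (fun w => T j r (mergeBlock n k j v w)) = fun w => τ j r (mergeBlock n k j v w) :=
        indF2_decide _
      rw [e1]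
      funext w
      rw [Finset.sum_apply]
      refine sum_congr rfl fun σ _ => ?_
      rw [Pi.smul_apply, smul_eq_mul, offExp_merge, mono_split (k := k) j σ.2.1, Pi.mul_apply,
        mono_merge_in, mono_merge_out]
      ring
    rw [hfun]
    refine Submodule.sum_mem _ fun σ hσ => Submodule.smul_mem _ _ (mono_mem_lowDeg ?_)
    have := hblk_card σ
    rw [(mem_filter.1 hσ).2] at this
    exact this
  /- Step H: evenness -/
  · intro u
    apply xor3_eq_false_of_sum
    rw [hτ]
    simp only
    rw [← sum_add_distrib, ← sum_add_distrib]
    refine sum_eq_zero fun σ hσ => ?_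
    have hns : ¬ Straddle n k j σ.1.val := by rw [← (mem_filter.1 hσ).2]; exact hblk_ns σ
    have h3 := nz3_triple (c + σ.1.val + offExp n k j σ.1.val u) (eCoef n k j σ.1.val)
      (eCoef_cases _ _)
    have er : ∀ r : ℕ, c + σ.1.val + eCoef n k j σ.1.val * r + offExp n k j σ.1.val u =
        c + σ.1.val + offExp n k j σ.1.val u + eCoef n k j σ.1.val * r := fun r => by ring
    rw [er 0, er 1, er 2, ← mul_add, ← mul_add, h3, mul_zero]
  /- Steps B, C, F: `WIN = ⊕_j X_j` -/
  · intro u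
    -- both sides are parities; compare them in `𝔽₂`
    unfold ringWinU
    rw [decide_eq_decide, mod_two_eq_one_iff, mod_two_eq_one_iff, card_filter_mod_two,
      card_filter_mod_two]
    -- the win count in `𝔽₂` is the sum over all terms
    have hW : (∑ g : Fin (n + 1), (if (y g u = true ∧ (c + g.val + walkExp u g.val) % 3 ≠ 0)
        then (1 : ZMod 2) else 0)) =
        ∑ σ ∈ Tm, a σ.1 σ.2 * mono (ZMod 2) σ.2.1 u * nz3 (c + σ.1.val + walkExp u σ.1.val) := by
      rw [hTm, sum_sigma]
      refine sum_congr rfl fun g _ => ?_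
      have e1 : (if (y g u = true ∧ (c + g.val + walkExp u g.val) % 3 ≠ 0) then (1 : ZMod 2) else 0)
          = indF2 (y g) u * nz3 (c + g.val + walkExp u g.val) := by
        unfold indF2 nz3
        by_cases h1 : y g u = true <;> by_cases h2 : (c + g.val + walkExp u g.val) % 3 = 0 <;>
          simp [h1, h2]
      rw [e1, hyu g u, sum_mul]
    -- the sum of the block parts is the same sum, fibrewise
    have hX : (∑ j ∈ range k, (if T j (blockWt n k j u % 3) u = true then (1 : ZMod 2) else 0)) =
        ∑ σ ∈ Tm, a σ.1 σ.2 * mono (ZMod 2) σ.2.1 u * nz3 (c + σ.1.val + walkExp u σ.1.val) := by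
      have e1 : ∀ j, (if T j (blockWt n k j u % 3) u = true then (1 : ZMod 2) else 0) =
          τ j (blockWt n k j u % 3) u := by
        intro j
        have := congrFun (indF2_decide (τ j (blockWt n k j u % 3))) u
        unfold indF2 at this
        exact this
      simp only [e1]
      rw [hτ]
      simp only
      rw [← sum_fiberwise_of_maps_to (s := Tm) (t := range k) (g := blk)
        (fun σ _ => mem_range.2 (hblk_lt σ))]
      refine sum_congr rfl fun j _ => sum_congr rfl fun σ hσ => ?_
      have hj : blk σ = j := (mem_filter.1 hσ).2
      have hns : ¬ Straddle n k j σ.1.val := by rw [← hj]; exact hblk_ns σ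
      congr 1
      apply nz3_congr
      rw [walkExp_split hns u]
      rcases eCoef_cases (n := n) (k := k) j σ.1.val with h | h <;> rw [h] <;> omega
    rw [hW, hX]

/-- **`T10W` hangs on tensor multiplicativity alone**: for any block degree `t` and ratio
`β > 2^{-(t+1)}`, `TensorMult t β → T10W` (block splitting is now a theorem). -/
theorem t10W_of_tensorMult (t : ℕ) (β : ℝ) (hβ : (2 : ℝ) ^ (-((t : ℝ) + 1)) < β)
    (h : TensorMult t β) : T10W :=
  tensorMultPays t β hβ (blockSplit t) h

/-- **MULT₁ pays**: `TensorMultOne → T10W` (ROUND-12: "T10W hangs on `TensorMultOne` alone"). -/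
theorem t10W_of_tensorMultOne (h : TensorMultOne) : T10W := multOnePays (blockSplit 1) h

end Summit.QuantumAdvantage.AdviceFreeQNC0
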